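import Summits.Ventures.CertifiedQuantumChemistry.Rows.SectorRows
import Summits.Ventures.CertifiedQuantumChemistry.Rows.SweepContraction
import HarnessLib

/-!
# Ventures/CertifiedQuantumChemistry — Rows/EnclosureUpperRow.lean: outward-rounded enclosures of the
# Rayleigh data of ANY sector vector ⇒ `UpperCertificate` / `UpperRow` / `E₀ ≤ max (b/n₁) (b/n₂)`
# (LADDER-CHEM I-TYPE slot 10 (i); the witness-generic form of FORMAT-qcu0 §3 / FORMAT-qcmps0 §4 BOUND)

HONEST FRAMING (verbatim, page 1 of every file of the cell): certified bounds for a stated model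
Hamiltonian in a stated basis; not a claim about the real molecule or material beyond that model.
CERTIFIED = inequalities on `E₀` (or `ΔE₀`) of files pinned by sha256 from replayed exact
certificates with typed soundness lemmas; VALIDATED = everything mapping model → reality.

Typer chem-type-10 (LADDER-CHEM cell chem-oracle, I-TYPE slot 10 (i)), zero compute, PROVED glue
only: every theorem below is a one- or two-line instantiation of decls already in the tree
(`le_mul_of_enclosure`, `le_max_div_mul_of_enclosure` — the VALUE RULE with its sign cases,
`Rows/SweepContraction.lean` §ValueRule; `sectorGroundEnergy_le_of_rayleigh` — Rayleigh–Ritz in the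
`(N_α, N_β)` sector, `Literature/…/SecondQuantizedHamiltonian.lean`; `upperRow_of_certificate` —
`Rows/SectorRows.lean`). No definition, no claim node, nothing asserted about any model.

WHAT THIS FILE ADDS (audit line `AUDIT 10`, HOME/STATUS.md): the tree already carries the value rule
and the complete MPS-specific kernel chain (`Rows/MPSUpperBound.lean`:
`upperCertificate_of_mps_configSums`, `upperCertificate_of_mps_sweeps`, `upperRow_of_mps_charges_sweeps`)
and the sweep error budget (`Rows/SweepErrorBudget.lean`: `sweep_norm_sub_le_budget_last`). What was
not stated as a named decl is the WITNESS-GENERIC row-level form that both upper lines of the ladder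
instantiate (chem-solver-3: exact-ℚ selected-CI Rayleigh quotients AND interval-contracted MPS;
pub-qchem FORMAT-qcu0 §3 "BOUND", FORMAT-qcmps0 §4): for ANY vector `ψ` supported on the `(a, b)`
determinant sector of a model `F : Model k`, outward-rounded enclosures

  `Re ⟨ψ, H_F ψ⟩ ≤ b`,   `0 < n₁ ≤ ⟨ψ, ψ⟩ ≤ n₂`

(however obtained: exact rational arithmetic, interval arithmetic with directed rounding, a float
evaluation plus an a-priori/a-posteriori error budget — `enclosure_of_abs_sub_le`) give

* `energy_le_max_div_of_enclosure`:  `E₀(H_F; a, b) ≤ max (b/n₁) (b/n₂)` (branch-free form), and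
  `energy_le_ite_div_of_enclosure`: `E₀(H_F; a, b) ≤ (b/n₁ if 0 ≤ b else b/n₂)` — THE SIGN CASES
  EXACTLY: for `b ≥ 0` the quotient is largest at the SMALLEST admissible norm `n₁`, for `b < 0` at the
  LARGEST admissible norm `n₂` (dividing a negative numerator by a larger denominator moves it up);
  the lower end of the energy enclosure is never used (an upper bound needs only the upper end);
  `n₁ > 0` is essential (it certifies `ψ ≠ 0` and the direction of every division);
* `upperCertificate_of_enclosure` / `upperRow_of_enclosure`: the typer's predicates
  `UpperCertificate F a b hi` (no symmetry of `F` needed — variational data) and `UpperRow F a b hi`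
  (for `F.IsSymmetric`, via `upperRow_of_certificate`) for every issued rational
  `hi ≥ max (b/n₁) (b/n₂)` — e.g. the dyadic `E_U = ⌈2^e · sup⌉ / 2^e` of FORMAT-qcu0 §3;
* `upperRow_of_budget`: the same with the energy enclosure presented as a computed value `x̂` and a
  budget `e` with `|x̂ − Re⟨ψ,H_Fψ⟩| ≤ e` (the END form of `Rows/SweepErrorBudget.lean`), `b := x̂ + e`.

Composition with I-TYPE slot 06 (generic variational upper lemma in a sector): the only variational
input used here is `sectorGroundEnergy_le_of_rayleigh`; a restated generic lemma of slot 06 can be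
substituted for it without touching the statements. References: pub-qchem `FORMAT-qcu0-v1.md` §3
(BOUND rule `sup := hhi/nlo if hhi ≥ 0 else hhi/nhi`), `FORMAT-qcmps0.md` §4; H. Tasaki, *Physics and
Mathematics of Quantum Many-Body Systems* (2020) §2.2 (Rayleigh–Ritz; the tree's
`sectorGroundEnergy_le_of_rayleigh`); N. J. Higham, *Accuracy and Stability of Numerical Algorithms*
(2002) §3.1 (running error bounds; the tree's `Rows/SweepErrorBudget.lean`).
-/

noncomputable section

namespace Summit.Ventures.CertifiedQuantumChemistry

open Matrix
open Literature.MathematicalPhysics.QuantumLattice Literature.MathematicalPhysics.QuantumChemistry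

variable {k : ℕ}

/-! ## Enclosures from a computed value and an error budget -/

/-- **Outward rounding from a budget.** A computed value `xh` with `|xh − x| ≤ e` encloses the exact
value: `xh − e ≤ x ≤ xh + e` (the form in which `Rows/SweepErrorBudget.lean` delivers the swept
numbers: `‖L̂_k[END] − ⟨ψ|H|ψ⟩‖ ≤ e_k[END]`). -/
theorem enclosure_of_abs_sub_le {x xh e : ℝ} (h : |xh - x| ≤ e) : xh - e ≤ x ∧ x ≤ xh + e := by
  obtain ⟨h1, h2⟩ := abs_le.mp h
  constructor <;> linarith

/-! ## The witness-generic value rule on the certified quantity `Model.energy` -/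

/-- A vector with a positive norm enclosure `0 < n₁ ≤ Re⟨ψ,ψ⟩` is nonzero. -/
theorem ne_zero_of_norm_enclosure {ψ : Fock (Orb (Fin k))} {nlo : ℝ} (hlo : nlo ≤ (star ψ ⬝ᵥ ψ).re)
    (hpos : 0 < nlo) : ψ ≠ 0 := by
  rintro rfl
  have h : 0 < (star (0 : Fock (Orb (Fin k))) ⬝ᵥ (0 : Fock (Orb (Fin k)))).re := hpos.trans_le hlo
  simp at h

/-- **`E₀ ≤ max (b/n₁) (b/n₂)` (branch-free value rule on the certified quantity).** For a symmetric
model `F`, a vector `ψ` supported on the `(a, b)` sector, and enclosures `Re⟨ψ, H_F ψ⟩ ≤ ehi`,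
`0 < nlo ≤ Re⟨ψ, ψ⟩ ≤ nhi`: `F.energy a b ≤ max (ehi/nlo) (ehi/nhi)`. One-line composition of
`le_max_div_mul_of_enclosure` (value rule) with `sectorGroundEnergy_le_of_rayleigh` (Rayleigh–Ritz). -/
theorem energy_le_max_div_of_enclosure {F : Model k} (hF : F.IsSymmetric) {a b : ℕ}
    {ψ : Fock (Orb (Fin k))} (hψ : IsInSector a b ψ) {ehi nlo nhi : ℝ}
    (hh : (star ψ ⬝ᵥ F.hamiltonian *ᵥ ψ).re ≤ ehi) (hlo : nlo ≤ (star ψ ⬝ᵥ ψ).re)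
    (hnhi : (star ψ ⬝ᵥ ψ).re ≤ nhi) (hpos : 0 < nlo) :
    F.energy a b ≤ max (ehi / nlo) (ehi / nhi) :=
  sectorGroundEnergy_le_of_rayleigh (Model.hamiltonian_isHermitian hF) hψ
    (ne_zero_of_norm_enclosure hlo hpos) (le_max_div_mul_of_enclosure hh hlo hnhi hpos)

/-- **The sign cases exactly (FORMAT-qcu0 §3 "BOUND": `sup := hhi/nlo if hhi ≥ 0 else hhi/nhi`).**
Under the same enclosures, `F.energy a b ≤ (ehi/nlo if 0 ≤ ehi else ehi/nhi)`: a non-negative energy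
enclosure is divided by the LOWER norm end, a negative one by the UPPER norm end. One-line composition
of `le_mul_of_enclosure` with `sectorGroundEnergy_le_of_rayleigh`. -/
theorem energy_le_ite_div_of_enclosure {F : Model k} (hF : F.IsSymmetric) {a b : ℕ}
    {ψ : Fock (Orb (Fin k))} (hψ : IsInSector a b ψ) {ehi nlo nhi : ℝ}
    (hh : (star ψ ⬝ᵥ F.hamiltonian *ᵥ ψ).re ≤ ehi) (hlo : nlo ≤ (star ψ ⬝ᵥ ψ).re)
    (hnhi : (star ψ ⬝ᵥ ψ).re ≤ nhi) (hpos : 0 < nlo) :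
    F.energy a b ≤ if 0 ≤ ehi then ehi / nlo else ehi / nhi :=
  sectorGroundEnergy_le_of_rayleigh (Model.hamiltonian_isHermitian hF) hψ
    (ne_zero_of_norm_enclosure hlo hpos) (le_mul_of_enclosure hh hlo hnhi hpos le_rfl)

/-! ## The typer's predicates from enclosures -/

/-- **Enclosures ⇒ `UpperCertificate F a b hi`** for any model `F` (no symmetry needed: the predicate
is variational data), any sector vector `ψ`, enclosures `Re⟨ψ,H_Fψ⟩ ≤ ehi`, `0 < nlo ≤ Re⟨ψ,ψ⟩ ≤ nhi`
and any issued rational `hi ≥ max (ehi/nlo) (ehi/nhi)`. The witness is `ψ` itself. -/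
theorem upperCertificate_of_enclosure (F : Model k) {a b : ℕ} {ψ : Fock (Orb (Fin k))}
    (hψ : IsInSector a b ψ) {ehi nlo nhi : ℝ} (hh : (star ψ ⬝ᵥ F.hamiltonian *ᵥ ψ).re ≤ ehi)
    (hlo : nlo ≤ (star ψ ⬝ᵥ ψ).re) (hnhi : (star ψ ⬝ᵥ ψ).re ≤ nhi) (hpos : 0 < nlo) {hi : ℚ}
    (hE : max (ehi / nlo) (ehi / nhi) ≤ ((hi : ℚ) : ℝ)) : UpperCertificate F a b hi :=
  ⟨ψ, hψ, ne_zero_of_norm_enclosure hlo hpos, (le_max_div_mul_of_enclosure hh hlo hnhi hpos).trans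
    (mul_le_mul_of_nonneg_right hE (hpos.trans_le hlo).le)⟩

/-- **Enclosures ⇒ `UpperRow F a b hi`** for a symmetric model (Rayleigh–Ritz via
`upperRow_of_certificate`; the witness supplies the range `a, b ≤ k`). -/
theorem upperRow_of_enclosure {F : Model k} (hF : F.IsSymmetric) {a b : ℕ} {ψ : Fock (Orb (Fin k))}
    (hψ : IsInSector a b ψ) {ehi nlo nhi : ℝ} (hh : (star ψ ⬝ᵥ F.hamiltonian *ᵥ ψ).re ≤ ehi)
    (hlo : nlo ≤ (star ψ ⬝ᵥ ψ).re) (hnhi : (star ψ ⬝ᵥ ψ).re ≤ nhi) (hpos : 0 < nlo) {hi : ℚ}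
    (hE : max (ehi / nlo) (ehi / nhi) ≤ ((hi : ℚ) : ℝ)) : UpperRow F a b hi :=
  upperRow_of_certificate hF (upperCertificate_of_enclosure F hψ hh hlo hnhi hpos hE)

/-- **Sign-case issue rule ⇒ `UpperRow`.** As `upperRow_of_enclosure`, with the issued rational checked
against the printed branch `hi ≥ (ehi/nlo if 0 ≤ ehi else ehi/nhi)` instead of the `max`. -/
theorem upperRow_of_enclosure_ite {F : Model k} (hF : F.IsSymmetric) {a b : ℕ}
    {ψ : Fock (Orb (Fin k))} (hψ : IsInSector a b ψ) {ehi nlo nhi : ℝ}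
    (hh : (star ψ ⬝ᵥ F.hamiltonian *ᵥ ψ).re ≤ ehi) (hlo : nlo ≤ (star ψ ⬝ᵥ ψ).re)
    (hnhi : (star ψ ⬝ᵥ ψ).re ≤ nhi) (hpos : 0 < nlo) {hi : ℚ}
    (hE : (if 0 ≤ ehi then ehi / nlo else ehi / nhi) ≤ ((hi : ℚ) : ℝ)) : UpperRow F a b hi :=
  upperRow_of_certificate hF ⟨ψ, hψ, ne_zero_of_norm_enclosure hlo hpos,
    le_mul_of_enclosure hh hlo hnhi hpos hE⟩

/-- **Computed value + budget ⇒ `UpperRow`.** The energy enclosure presented as the arithmetic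
lineages deliver it: a computed number `xh` (float / interval midpoint sweep result) with a certified
budget `|xh − Re⟨ψ,H_Fψ⟩| ≤ e` (`Rows/SweepErrorBudget.lean`, END form), norm enclosure
`0 < nlo ≤ Re⟨ψ,ψ⟩ ≤ nhi`, and an issued `hi ≥ max ((xh + e)/nlo) ((xh + e)/nhi)`. -/
theorem upperRow_of_budget {F : Model k} (hF : F.IsSymmetric) {a b : ℕ} {ψ : Fock (Orb (Fin k))}
    (hψ : IsInSector a b ψ) {xh e nlo nhi : ℝ} (hxe : |xh - (star ψ ⬝ᵥ F.hamiltonian *ᵥ ψ).re| ≤ e)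
    (hlo : nlo ≤ (star ψ ⬝ᵥ ψ).re) (hnhi : (star ψ ⬝ᵥ ψ).re ≤ nhi) (hpos : 0 < nlo) {hi : ℚ}
    (hE : max ((xh + e) / nlo) ((xh + e) / nhi) ≤ ((hi : ℚ) : ℝ)) : UpperRow F a b hi :=
  upperRow_of_enclosure hF hψ (enclosure_of_abs_sub_le hxe).2 hlo hnhi hpos hE

end Summit.Ventures.CertifiedQuantumChemistry

end
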